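import Mathlib
import HarnessLib
import Summits.NavierStokesRegularity.NavierStokesRegularity.Theorems.TaylorModelRungThreeCertificateBoxFieldDFast

/-!
# Crux K1b-DR (stmt-NavierStokesRegularity-23954), line `taylor-model` — the SPARSE interval twin `qBboxMA` of the truncated field
# (active-monomial lists per target coordinate, computed once) and its soundness `isFieldEnclosureA_qBboxMA`

MEASURED (farm `native_decide`, n = 88, 22 non-zero α, state jets to order 13 = 91 field calls, `…BoxFieldDFast` docstring): full-table
twins spend their time iterating the 64 monomial slots of every target; a twin that folds only over the ACTIVE monomials of each target
coordinate (non-zero coefficient box AND both factors on the window — a list computed ONCE per certificate, `monosTable`) runs the whole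
order-13 state-jet table in ≈ 1.6 s (≈ 0.017 s per call, ×20 vs `QbBoxA`). This file: `tripleList` (the 64 index triples), `isActive`,
`activeMonos T coefB c := tripleList.filter (isActive …)`, `monosTable`, the monomial box `monoBox` (coefficient box × factor boxes, no
test), the fold `qBboxM` and the array twin `qBboxMA T coefB prec mt` (to be called with `mt := T.monosTable coefB`, bound once); the
generic fold lemma `mem_sum_filter_foldl` (a list sum whose inactive terms vanish lies in the rounded fold over the active sublist), the
64-term identity `sum3_eq_tripleList`, and **`isFieldEnclosureA_qBboxMA : IsFieldEnclosureA T.wv (qBf d) T.n (T.qBboxMA coefB prec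
(T.monosTable coefB))`** — plug into the `…_qBf` theorems of `…BoxFieldDFast` for J / JV / JD / R2D.

MODEL-lattice bookkeeping only (rung TL-M3); nothing here concerns the Navier–Stokes equations.
-/

-- the sub-problem namespace repeats the summit name by design (D-0017)
set_option linter.dupNamespace false

namespace Summit.NavierStokesRegularity.NavierStokesRegularity.Theorems.TaylorModelCert

open scoped BigOperators
open Literature.Analysis.FluidPDE.TaoCascade Literature.Analysis.FluidPDE.TaoCascade.TaylorChain
open Summit.NavierStokesRegularity.NavierStokesRegularity.Theorems.TaylorModelReadout (trunc trunc_apply qB)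

namespace IntervalD

/-- **Fold enclosure with vanishing inactive terms**: if every inactive term of a list vanishes and every active term lies in its box,
the sum of ALL terms lies in the rounded left fold of the boxes over the ACTIVE sublist. [folklore] -/
theorem mem_sum_filter_foldl {τ : Type*} (prec : ℕ) (F : τ → ℝ) (box : τ → IntervalD) (p : τ → Bool) :
    ∀ (l : List τ), (∀ t ∈ l, p t = false → F t = 0) → (∀ t ∈ l, p t = true → mem (F t) (box t)) →
      ∀ (acc : ℝ) (A : IntervalD), mem acc A →
        mem (acc + (l.map F).sum) ((l.filter p).foldl (fun B t => addR prec B (box t)) A)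
  | [], _, _, acc, A, hA => by simpa using hA
  | t :: l, hz, hm, acc, A, hA => by
    rw [List.map_cons, List.sum_cons, List.filter_cons]
    by_cases hp : p t = true
    · rw [if_pos hp, List.foldl_cons, ← add_assoc]
      exact mem_sum_filter_foldl prec F box p l (fun s hs => hz s (List.mem_cons_of_mem t hs))
        (fun s hs => hm s (List.mem_cons_of_mem t hs)) _ _ (mem_addR prec hA (hm t List.mem_cons_self hp))
    · rw [if_neg hp, hz t List.mem_cons_self (by simpa using hp), zero_add]
      exact mem_sum_filter_foldl prec F box p l (fun s hs => hz s (List.mem_cons_of_mem t hs))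
        (fun s hs => hm s (List.mem_cons_of_mem t hs)) _ _ hA

/-- A point-zero box forces its member to vanish. [folklore] -/
theorem eq_zero_of_mem_pointZero {x : ℝ} {I : IntervalD} (h : I.lo.m = 0 ∧ I.hi.m = 0) (hx : mem x I) : x = 0 := by
  obtain ⟨h1, h2⟩ := hx
  simp only [Dyad.toReal, h.1, h.2, Int.cast_zero, zero_mul] at h1 h2
  exact le_antisymm h2 h1

end IntervalD

namespace CertTables

/-! ### The 64 monomial index triples -/

/-- The index triples `(a, b, μ)` of the monomials of one target mode, in table order. [folklore] -/
def tripleList : List (ℕ × ℕ × ℕ) :=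
  [(0, 0, 0), (0, 0, 1), (0, 0, 2), (0, 0, 3), (0, 1, 0), (0, 1, 1), (0, 1, 2), (0, 1, 3),
   (0, 2, 0), (0, 2, 1), (0, 2, 2), (0, 2, 3), (0, 3, 0), (0, 3, 1), (0, 3, 2), (0, 3, 3),
   (1, 0, 0), (1, 0, 1), (1, 0, 2), (1, 0, 3), (1, 1, 0), (1, 1, 1), (1, 1, 2), (1, 1, 3),
   (1, 2, 0), (1, 2, 1), (1, 2, 2), (1, 2, 3), (1, 3, 0), (1, 3, 1), (1, 3, 2), (1, 3, 3),
   (2, 0, 0), (2, 0, 1), (2, 0, 2), (2, 0, 3), (2, 1, 0), (2, 1, 1), (2, 1, 2), (2, 1, 3),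
   (2, 2, 0), (2, 2, 1), (2, 2, 2), (2, 2, 3), (2, 3, 0), (2, 3, 1), (2, 3, 2), (2, 3, 3),
   (3, 0, 0), (3, 0, 1), (3, 0, 2), (3, 0, 3), (3, 1, 0), (3, 1, 1), (3, 1, 2), (3, 1, 3),
   (3, 2, 0), (3, 2, 1), (3, 2, 2), (3, 2, 3), (3, 3, 0), (3, 3, 1), (3, 3, 2), (3, 3, 3)]

/-- Every triple has components `< 4`. [folklore] -/
theorem tripleList_lt : ∀ t ∈ tripleList, t.1 < 4 ∧ t.2.1 < 4 ∧ t.2.2 < 4 := by decide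

/-- The triple `range 4` sum is the sum over `tripleList`. [folklore] -/
theorem sum3_eq_tripleList (G : ℕ → ℕ → ℕ → ℝ) :
    ∑ a ∈ Finset.range 4, ∑ b ∈ Finset.range 4, ∑ μi ∈ Finset.range 4, G a b μi =
      (tripleList.map fun t => G t.1 t.2.1 t.2.2).sum := by
  simp only [Finset.sum_range_succ, Finset.sum_range_zero, zero_add, tripleList, List.map_cons, List.map_nil, List.sum_cons,
    List.sum_nil, add_zero]
  ring

section Defs

variable {K : Type} [Field K] [LinearOrder K]

/-- A monomial of target `(i, k)` is ACTIVE if both factors are on the window and its coefficient box is not the point `0`. [folklore] -/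
def isActive (T : CertTables K) (coefB : Fin 4 → Fin 4 → Fin 4 → ℕ → ℤ → IntervalD) (i : Fin 4) (k : ℤ) (t : ℕ × ℕ × ℕ) : Bool :=
  decide ((-T.Kb ≤ fShell₁ t.2.2 k ∧ fShell₁ t.2.2 k ≤ T.Ka) ∧ (-T.Kb ≤ fShell₂ t.2.2 k ∧ fShell₂ t.2.2 k ≤ T.Ka)) &&
    !decide ((coefB ⟨t.1 % 4, Nat.mod_lt _ (by omega)⟩ ⟨t.2.1 % 4, Nat.mod_lt _ (by omega)⟩ i t.2.2 k).lo.m = 0 ∧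
      (coefB ⟨t.1 % 4, Nat.mod_lt _ (by omega)⟩ ⟨t.2.1 % 4, Nat.mod_lt _ (by omega)⟩ i t.2.2 k).hi.m = 0)

/-- The active monomials of the window coordinate `c`. [folklore] -/
def activeMonos (T : CertTables K) (coefB : Fin 4 → Fin 4 → Fin 4 → ℕ → ℤ → IntervalD) (c : ℕ) : List (ℕ × ℕ × ℕ) :=
  tripleList.filter (T.isActive coefB (T.wi c) (T.wk c))

/-- The table of active-monomial lists, one per window coordinate `c < n` (compute ONCE per certificate). [folklore] -/
def monosTable (T : CertTables K) (coefB : Fin 4 → Fin 4 → Fin 4 → ℕ → ℤ → IntervalD) : Array (List (ℕ × ℕ × ℕ)) :=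
  Array.ofFn fun c : Fin T.n => T.activeMonos coefB c

/-- Reader of the monomial table (junk `[]`). [folklore] -/
def tget (mt : Array (List (ℕ × ℕ × ℕ))) (c : ℕ) : List (ℕ × ℕ × ℕ) := if h : c < mt.size then mt[c] else []

/-- The box of one monomial at target `(i, k)`: coefficient box × box of factor 1 × box of factor 2 (rounded). [folklore] -/
def monoBox (T : CertTables K) (coefB : Fin 4 → Fin 4 → Fin 4 → ℕ → ℤ → IntervalD) (prec : ℕ) (U W : ℕ → IntervalD)
    (i : Fin 4) (k : ℤ) (t : ℕ × ℕ × ℕ) : IntervalD :=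
  IntervalD.mulR prec (IntervalD.mulR prec (coefB ⟨t.1 % 4, Nat.mod_lt _ (by omega)⟩ ⟨t.2.1 % 4, Nat.mod_lt _ (by omega)⟩ i t.2.2 k)
    (U (T.idx ⟨t.1 % 4, Nat.mod_lt _ (by omega)⟩ (fShell₁ t.2.2 k)))) (W (T.idx ⟨t.2.1 % 4, Nat.mod_lt _ (by omega)⟩ (fShell₂ t.2.2 k)))

/-- **SPARSE interval evaluation of the truncated bilinear field** at target `(i, k)` over a given monomial list (rounded left fold).
[folklore] -/
def qBboxM (T : CertTables K) (coefB : Fin 4 → Fin 4 → Fin 4 → ℕ → ℤ → IntervalD) (prec : ℕ) (U W : ℕ → IntervalD)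
    (i : Fin 4) (k : ℤ) (l : List (ℕ × ℕ × ℕ)) : IntervalD :=
  l.foldl (fun acc t => IntervalD.addR prec acc (T.monoBox coefB prec U W i k t)) (IntervalD.ofInt 0)

/-- The SPARSE array twin of the field: per coordinate `c < n` the fold over `mt[c]`; sound when `mt = T.monosTable coefB`. [folklore] -/
def qBboxMA (T : CertTables K) (coefB : Fin 4 → Fin 4 → Fin 4 → ℕ → ℤ → IntervalD) (prec : ℕ) (mt : Array (List (ℕ × ℕ × ℕ)))
    (A B : Array IntervalD) : Array IntervalD :=
  Array.ofFn fun c : Fin T.n => T.qBboxM coefB prec (IntervalD.aget A) (IntervalD.aget B) (T.wi c) (T.wk c) (tget mt c)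

end Defs

section Sound

variable {K : Type} [Field K] {φ : K →+* ℝ} (T : CertTables K) {coefB : Fin 4 → Fin 4 → Fin 4 → ℕ → ℤ → IntervalD}

omit [Field K] in
/-- The monomial table reads the active list below `n`. [folklore] -/
theorem tget_monosTable {c : ℕ} (hc : c < T.n) : tget (T.monosTable coefB) c = T.activeMonos coefB c := by
  unfold tget monosTable
  rw [dif_pos (by rw [Array.size_ofFn]; exact hc), Array.getElem_ofFn]

/-- **`qB` over interval boxes, sparse twin**: `qB d u w (wi c) (wk c) ∈ qBboxM … (activeMonos c)` for `c < n`. [folklore] -/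
theorem mem_qB_boxM (hco : T.CoefOK φ) (hcB : CoefBoxOK φ T coefB) {u w : Fin 4 → ℤ → ℝ} {U W : ℕ → IntervalD}
    (hu : ∀ c < T.n, IntervalD.mem (T.wv u c) (U c)) (hw : ∀ c < T.n, IntervalD.mem (T.wv w c) (W c))
    {c : ℕ} (hc : c < T.n) (prec : ℕ) :
    IntervalD.mem (qB (T.toCertData φ) u w (T.wi c) (T.wk c))
      (T.qBboxM coefB prec U W (T.wi c) (T.wk c) (T.activeMonos coefB c)) := by
  set d := T.toCertData φ with hd
  set i := T.wi c
  set k := T.wk c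
  have hk : -T.Kb ≤ k ∧ k ≤ T.Ka := T.InW_wk hc
  have hKb : d.Kb = T.Kb := rfl
  have hKa : d.Ka = T.Ka := rfl
  have hu' : ∀ (a' : Fin 4) {k' : ℤ}, (-T.Kb ≤ k' ∧ k' ≤ T.Ka) → IntervalD.mem (u a' k') (U (T.idx a' k')) := by
    intro a' k' hk'
    have h := hu (T.idx a' k') (T.idx_lt_n a' hk')
    rwa [T.wv_idx u a' hk'] at h
  have hw' : ∀ (a' : Fin 4) {k' : ℤ}, (-T.Kb ≤ k' ∧ k' ≤ T.Ka) → IntervalD.mem (w a' k') (W (T.idx a' k')) := by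
    intro a' k' hk'
    have h := hw (T.idx a' k') (T.idx_lt_n a' hk')
    rwa [T.wv_idx w a' hk'] at h
  unfold qB qBboxM activeMonos
  rw [hKb, hKa, if_pos hk]
  simp only [sum_fin4_eq, sum_shiftSet_eq]
  rw [sum3_eq_tripleList, ← zero_add (List.sum _)]
  refine IntervalD.mem_sum_filter_foldl prec _ _ _ tripleList (fun t ht hin => ?_) (fun t ht hact => ?_) 0 _ IntervalD.mem_zero
  all_goals
    obtain ⟨a, b, μi⟩ := t
    obtain ⟨-, -, hμ⟩ := tripleList_lt _ ht
    dsimp only at hμ ⊢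
    set a' : Fin 4 := ⟨a % 4, Nat.mod_lt _ (by omega)⟩
    set b' : Fin 4 := ⟨b % 4, Nat.mod_lt _ (by omega)⟩
    have hs1 : k - (shifts.getD μi (0, 0, 0)).2.2 + (shifts.getD μi (0, 0, 0)).1 = fShell₁ μi k := rfl
    have hs2 : k - (shifts.getD μi (0, 0, 0)).2.2 + (shifts.getD μi (0, 0, 0)).2.1 = fShell₂ μi k := rfl
    simp only [trunc_apply]
    rw [hs1, hs2, hKb, hKa]
    have hcoef : d.α a' b' i (shifts.getD μi (0, 0, 0)) * (1 + 1 : ℝ) ^ ((5 : ℝ) * (k - (shifts.getD μi (0, 0, 0)).2.2) / 2) =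
        φ (T.coefAt a' b' i μi k) := by
      rw [hco a' b' i μi k hμ hk.1 hk.2, hd, toCertData_α, shifts_getD μi hμ, if_pos hμ, one_add_one_eq_two]
    rw [hcoef]
  · -- inactive: off-window or point-zero coefficient
    simp only [isActive, Bool.and_eq_false_iff, Bool.not_eq_false', decide_eq_false_iff_not, decide_eq_true_eq] at hin
    rcases hin with hwin | hz
    · have hzero : (if -T.Kb ≤ fShell₁ μi k ∧ fShell₁ μi k ≤ T.Ka then u a' (fShell₁ μi k) else 0) *
          (if -T.Kb ≤ fShell₂ μi k ∧ fShell₂ μi k ≤ T.Ka then w b' (fShell₂ μi k) else 0) = 0 := by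
        rcases not_and_or.1 hwin with h1 | h2
        · rw [if_neg h1, zero_mul]
        · rw [if_neg h2, mul_zero]
      rw [hzero, mul_zero]
    · rw [IntervalD.eq_zero_of_mem_pointZero hz (hcB a' b' i μi k hμ hk.1 hk.2), zero_mul]
  · -- active: both factors on the window
    simp only [isActive, Bool.and_eq_true, decide_eq_true_eq] at hact
    obtain ⟨⟨h1, h2⟩, -⟩ := hact
    rw [if_pos h1, if_pos h2, ← mul_assoc]
    exact IntervalD.mem_mulR prec (IntervalD.mem_mulR prec (hcB a' b' i μi k hμ hk.1 hk.2) (hu' a' h1)) (hw' b' h2)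

/-- **The sparse array twin is an interval extension of `qB d`** (feed to the `…_qBf` theorems of `…BoxFieldDFast`). [folklore] -/
theorem isFieldEnclosureA_qBboxMA (hco : T.CoefOK φ) (hcB : CoefBoxOK φ T coefB) (prec : ℕ) :
    IntervalD.IsFieldEnclosureA T.wv (qBf (T.toCertData φ)) T.n (T.qBboxMA coefB prec (T.monosTable coefB)) := by
  intro A B u w _ _ hu hw c hc
  unfold qBboxMA
  rw [IntervalD.aget_ofFn _ hc, T.tget_monosTable hc]
  exact T.mem_qB_boxM hco hcB hu hw hc prec

end Sound

end CertTables

end Summit.NavierStokesRegularity.NavierStokesRegularity.Theorems.TaylorModelCert
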